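import Summits.BirchSwinnertonDyer.BirchSwinnertonDyer.Theorems.AlignedTransportAtTwoMainConjectureTransportAlignedAtTwoOrdPlusLineWitnessMinusLaw
import Literature.NumberTheory.EllipticCurves.PAdicLFunctionMinus
import HarnessLib

/-!
# Crux C1 `MainConjectureTransportAlignedAtTwo` (stmt-BirchSwinnertonDyer-22296), line `birth`, the `Δ > 0` half (R1) of the promoted residual:
# THE ANTI-INVARIANT WITNESS IN ENGINE CURRENCY — imaginary parts of the depleted form's symbols are `Ω⁻_f` times the DEPLETED MINUS TABLE of `f`,
# so the witness is «a non-`2`-integral depleted minus value at the cusp `a/c` of a matrix `(a b; c a) ∈ Γ₀(N')`» (width seat att-p4 g12; `--supports 22296`)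

THEOREMS ONLY (no `def`, no `sorry`, no new named fact). BSD is not proved by this; C1 is not closed by this.

* §1 `im_modularSymbol_eq_minusPeriod_mul` (`im {∞,y}_f = Ω⁻_f·[y]⁻_f` for the newform of `W`, `…PAdicLFunctionMinus.ratMinusSymbol`);
  **`im_modularSymbol_depleted_eq`** — the Im-TWIN of the lead's `…DepletedPeriodFormula.re_modularSymbol_depleted_eq`: for the `S`-depleted form `g` of
  `f` at any admissible level, `im {∞, r}_g = Ω⁻_f · (eulerDepleteTableList W l [·]⁻_f)(r)` (same complex identity `modularSymbol_depleted_eq_act_of_dvd`,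
  minus symbols instead of plus symbols).
* §2 **`minusFunctional_cuspSymbol_eq`** — the minus functional of the selection files at a class `{∞, γ∞}`, `γ = (a b; c d)`, `c ≠ 0`:
  `(2D/Ω⁻_f)·im{∞,γ∞}_g = 2D·Ψ⁻(a/c)`, `Ψ⁻ = eulerDepleteTableList W l (ratMinusSymbol f)`; `odd_of_eq_two_mul_prod_sq_mul_of_one_lt_norm` — the
  integer `2D·Ψ⁻(a/c)` is ODD iff `‖Ψ⁻(a/c)‖₂ > 1` (`D` odd).
* §3 **`lamLaw_of_not_padicSquare_of_minusTable_witness`** — `…WitnessMinusLaw.lamLaw_of_not_padicSquare_of_matrix_witness` with the witness read as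
  «`∃ (a b; c a) ∈ Γ₀(N')`, `c ≠ 0`, `1 < ‖Ψ⁻_{W₁}(a/c)‖₂`» — a statement about finitely many MINUS MODULAR SYMBOLS `[m·a/c]⁻` of the first curve, in the
  currency of the lead's `μ`-certificate `…OrdPlusLineTools.exists_depleted_table_norm_gt_one` (data ask D-att-p4-2 of
  `Cruxes/…/DELTA-POS-WITNESS-att-p4-g12.md`).

References: Mazur–Tate–Teitelbaum 1986 §I.8 [MazurTateTeitelbaum1986Invent]; Cremona 1997 §2.8 [CremonaAlgorithms1997]; Greenberg–Vatsal 2000 §1 (8),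
§3 Rem. 3.4 [GreenbergVatsal2000]; Emerton–Pollack–Weston 2006 §3 (3.4)–(3.5) [EmertonPollackWeston2006]; Atkin–Lehner 1970 §3 [AtkinLehner1970].
-/

noncomputable section

-- justification: the `Summit.BirchSwinnertonDyer.BirchSwinnertonDyer.…` path repeats a component (route-file convention)
set_option linter.dupNamespace false
set_option autoImplicit false

open scoped MatrixGroups ModularForm NumberField Classical
open CongruenceSubgroup Complex WeierstrassCurve IsDedekindDomain Polynomial Module
open Literature.NumberTheory.EllipticCurves Literature.NumberTheory.EllipticCurves.ModularForms
open Literature.NumberTheory.EllipticCurves.Greenberg1999 Literature.NumberTheory.EllipticCurves.GreenbergVatsal2000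
open Summit.BirchSwinnertonDyer.Rank1Residual.F1Sign2 Summit.BirchSwinnertonDyer.Rank1Residual.X1.MuLambda
open Summit.BirchSwinnertonDyer.BirchSwinnertonDyer.Theorems.ThetaLayerLambdaCongruenceAtTwo
open Summit.BirchSwinnertonDyer.BirchSwinnertonDyer.Theorems.AlignedTransportAtTwoDepletedPeriodFormula
open Summit.BirchSwinnertonDyer.BirchSwinnertonDyer.Theorems.AlignedTransportAtTwoOrdPlusLineOdd
open Summit.BirchSwinnertonDyer.BirchSwinnertonDyer.Theorems.AlignedTransportAtTwoOrdPlusLineWitness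
open Summit.BirchSwinnertonDyer.BirchSwinnertonDyer.Theorems.AlignedTransportAtTwoOrdPlusLineWitnessClasses
open Summit.BirchSwinnertonDyer.BirchSwinnertonDyer.Theorems.AlignedTransportAtTwoOrdPlusLineWitnessMinusLaw

namespace Summit.BirchSwinnertonDyer.BirchSwinnertonDyer.Theorems.AlignedTransportAtTwoOrdPlusLineWitnessMinusTable

/-! ## §1 Imaginary parts of the depleted form's modular symbols = `Ω⁻_f` × the depleted minus table of `f` -/

section Tables

variable {W : WeierstrassCurve ℚ} [W.IsElliptic] [W.IsGloballyMinimal] [NeZero (W.conductorNorm ℤ)]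
  {f : CuspForm (Gamma0 (W.conductorNorm ℤ)) 2}

omit [W.IsElliptic] [W.IsGloballyMinimal] in
/-- `im {∞, y}_f = Ω⁻_f · [y]⁻_f` for the newform of `W` (`minusSymbol_eq_im_mul_I_holds`, `ratCast_ratMinusSymbol`, `Ω⁻_f > 0`).
[cite: MazurTateTeitelbaum1986Invent, §I.8] -/
theorem im_modularSymbol_eq_minusPeriod_mul (hf : IsNewformOf W f) (y : ℚ) :
    ((modularSymbol f y).im : ℂ) = (minusPeriod f : ℂ) * ((ratMinusSymbol f y : ℚ) : ℂ) := by
  have hQ := hf.coeffField_eq_bot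
  have hreal : ∀ n, (cuspCoeff f n).im = 0 := fun n ↦ by rw [hf.2 n, Complex.intCast_im]
  have hpos : 0 < minusPeriod f := IsNewform0.minusPeriod_pos_holds hf.1 hQ
  have h1 : (ratMinusSymbol f y : ℝ) = (minusSymbol f y).im / minusPeriod f := ratCast_ratMinusSymbol f hf.1 hQ y
  have h2 : minusSymbol f y = ((modularSymbol f y).im : ℂ) * I := minusSymbol_eq_im_mul_I_holds f hreal y
  have h2' : (minusSymbol f y).im = (modularSymbol f y).im := by
    rw [h2]; simp [Complex.mul_im]
  have h3 : (modularSymbol f y).im = minusPeriod f * (ratMinusSymbol f y : ℝ) := by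
    rw [h1, h2']; field_simp
  rw [h3]; push_cast; rfl

/-- **`im {∞, r}_g = Ω⁻_f · (∏_{v∈l} P_v(ℓ_v⁻¹[ℓ_v]) [·]⁻_f)(r)`** — Im-twin of `…DepletedPeriodFormula.re_modularSymbol_depleted_eq`: for the newform `f`
of `W` (globally minimal), a duplicate-free list `l` of places, a level `L` with `N_W·∏ℓ² ∣ L` and the `S`-depleted form `g ∈ S₂(Γ₀(L))`, the imaginary
part of every modular symbol of `g` is `Ω⁻_f` times the DEPLETED RATIONAL MINUS-SYMBOL TABLE `eulerDepleteTableList W l (ratMinusSymbol f)`.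
[cite: EmertonPollackWeston2006, §3 (3.4)–(3.5)] [cite: GreenbergVatsal2000, §1 (8)] [cite: MazurTateTeitelbaum1986Invent, §I.8] -/
theorem im_modularSymbol_depleted_eq (hf : IsNewformOf W f) (l : List (HeightOneSpectrum (𝓞 ℚ))) (hl : l.Nodup)
    (L : ℕ) [NeZero L]
    (hNL : W.conductorNorm ℤ * ∏ ℓ ∈ (l.map Rat.HeightOneSpectrum.natGenerator).toFinset, ℓ ^ 2 ∣ L)
    (g : CuspForm (Gamma0 L) 2)
    (hg : ∀ n : ℕ, cuspCoeff g n =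
      if ∃ ℓ ∈ (l.map Rat.HeightOneSpectrum.natGenerator).toFinset, ℓ ∣ n then 0 else cuspCoeff f n)
    (r : ℚ) :
    ((modularSymbol g r).im : ℂ) = (minusPeriod f : ℂ) * ((eulerDepleteTableList W l (ratMinusSymbol f) r : ℚ) : ℂ) := by
  classical
  have hS : ∀ ℓ ∈ (l.map Rat.HeightOneSpectrum.natGenerator).toFinset, ℓ.Prime := by
    intro ℓ hℓ
    rw [List.mem_toFinset, List.mem_map] at hℓ
    obtain ⟨w, -, rfl⟩ := hℓ
    exact Rat.HeightOneSpectrum.prime_natGenerator w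
  have hTf : ∀ (p : ℕ) (hp : p.Prime), (haveI : NeZero p := ⟨hp.ne_zero⟩; heckeT (Gamma0 (W.conductorNorm ℤ)) 2 p f) = cuspCoeff f p • f :=
    fun p hp ↦ by haveI : NeZero p := ⟨hp.ne_zero⟩; exact hf.1.heckeT_eq_coeff_smul hp
  have hgreal : ∀ n, (cuspCoeff g n).im = 0 := fun n ↦ by
    rw [hg n]; split_ifs
    · simp
    · rw [hf.2 n, Complex.intCast_im]
  have hfreal : ∀ n, (cuspCoeff f n).im = 0 := fun n ↦ by rw [hf.2 n, Complex.intCast_im]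
  -- the minus symbol of `g` and the complex period formula at `±r`
  have hmg : minusSymbol g r = ((modularSymbol g r).im : ℂ) * I := minusSymbol_eq_im_mul_I_holds g hgreal r
  have hact := modularSymbol_depleted_eq_act_of_dvd f hTf _ hS L hNL g (fun n ↦ by convert hg n using 2)
  have ha : ∀ ℓ : ℕ, cuspCoeff f ℓ = ((W.LFunction ℓ : ℤ) : ℂ) := fun ℓ ↦ hf.2 ℓ
  refine mul_left_injective₀ I_ne_zero ?_
  change ((modularSymbol g r).im : ℂ) * I = (minusPeriod f : ℂ) * ((eulerDepleteTableList W l (ratMinusSymbol f) r : ℚ) : ℂ) * I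
  rw [← hmg, minusSymbol, hact r, hact (-r)]
  simp_rw [ha]
  have hneg : ∀ m : ℕ, ((m : ℚ) * -r) = -((m : ℚ) * r) := fun m ↦ by ring
  simp_rw [hneg]
  have key := cast_eulerDepleteTableList_eq_act W l hl (ratMinusSymbol f) (minusPeriod f : ℂ)
    (fun y ↦ (minusPeriod f : ℂ) * ((ratMinusSymbol f y : ℚ) : ℂ)) (fun y ↦ rfl) r
  rw [key, ← Finsupp.sum_sub, div_eq_mul_inv, Finsupp.sum_mul, Finsupp.sum_mul]
  refine Finsupp.sum_congr fun m _ ↦ ?_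
  have hsym : modularSymbol f ((m : ℚ) * r) - modularSymbol f (-((m : ℚ) * r)) = 2 * minusSymbol f ((m : ℚ) * r) := by
    rw [minusSymbol]; ring
  rw [← mul_sub, hsym, minusSymbol_eq_im_mul_I_holds f hfreal, im_modularSymbol_eq_minusPeriod_mul hf]
  ring

/-! ## §2 The minus functional at a class `{∞, γ∞}` in table currency; oddness from a norm -/

/-- **`(2D/Ω⁻_f)·im{∞,γ∞}_g = 2D·Ψ⁻(a/c)`** for `γ = (a b; c d) ∈ Γ₀(L)` with `c ≠ 0`, `Ψ⁻ = eulerDepleteTableList W l [·]⁻_f`, `D = ∏ℓ²`: the minus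
functional of the selection files, at a class, is an explicit `ℤ`-combination of minus modular symbols `[m·a/c]⁻_f` of the FIRST curve.
[cite: GreenbergVatsal2000, §1 (8)] [cite: MazurTateTeitelbaum1986Invent, §I.8] -/
theorem minusFunctional_cuspSymbol_eq (hf : IsNewformOf W f) (l : List (HeightOneSpectrum (𝓞 ℚ))) (hl : l.Nodup)
    (L : ℕ) [NeZero L]
    (hNL : W.conductorNorm ℤ * ∏ ℓ ∈ (l.map Rat.HeightOneSpectrum.natGenerator).toFinset, ℓ ^ 2 ∣ L)
    (g : CuspForm (Gamma0 L) 2)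
    (hg : ∀ n : ℕ, cuspCoeff g n =
      if ∃ ℓ ∈ (l.map Rat.HeightOneSpectrum.natGenerator).toFinset, ℓ ∣ n then 0 else cuspCoeff f n)
    (γ : Gamma0 L) (hc : (γ : SL(2, ℤ)) 1 0 ≠ 0) :
    (2 * ((∏ ℓ ∈ (l.map Rat.HeightOneSpectrum.natGenerator).toFinset, ℓ ^ 2 : ℕ) : ℝ) / minusPeriod f) * (cuspSymbol g γ).im =
      ((2 * ((∏ ℓ ∈ (l.map Rat.HeightOneSpectrum.natGenerator).toFinset, ℓ ^ 2 : ℕ) : ℚ) *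
        eulerDepleteTableList W l (ratMinusSymbol f) ((((γ : SL(2, ℤ)) 0 0 : ℤ) : ℚ) / (((γ : SL(2, ℤ)) 1 0 : ℤ) : ℚ)) : ℚ) : ℝ) := by
  have hpos : 0 < minusPeriod f := IsNewform0.minusPeriod_pos_holds hf.1 hf.coeffField_eq_bot
  rw [cuspSymbol_eq_modularSymbol_of_ne_zero g γ hc]
  have h := im_modularSymbol_depleted_eq hf l hl L hNL g hg ((((γ : SL(2, ℤ)) 0 0 : ℤ) : ℚ) / (((γ : SL(2, ℤ)) 1 0 : ℤ) : ℚ))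
  have h' : (modularSymbol g ((((γ : SL(2, ℤ)) 0 0 : ℤ) : ℚ) / (((γ : SL(2, ℤ)) 1 0 : ℤ) : ℚ))).im =
      minusPeriod f * (eulerDepleteTableList W l (ratMinusSymbol f) ((((γ : SL(2, ℤ)) 0 0 : ℤ) : ℚ) / (((γ : SL(2, ℤ)) 1 0 : ℤ) : ℚ)) : ℝ) := by
    have : ((minusPeriod f : ℂ) * ((eulerDepleteTableList W l (ratMinusSymbol f)
        ((((γ : SL(2, ℤ)) 0 0 : ℤ) : ℚ) / (((γ : SL(2, ℤ)) 1 0 : ℤ) : ℚ)) : ℚ) : ℂ)) =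
        ((minusPeriod f * (eulerDepleteTableList W l (ratMinusSymbol f)
          ((((γ : SL(2, ℤ)) 0 0 : ℤ) : ℚ) / (((γ : SL(2, ℤ)) 1 0 : ℤ) : ℚ)) : ℝ) : ℝ) : ℂ) := by
      push_cast; rfl
    rw [this] at h
    exact_mod_cast h
  rw [h']
  push_cast
  field_simp

/-- **Oddness from a `2`-adic norm.** If `(w : ℝ) = 2D·t` with `w ∈ ℤ`, `t ∈ ℚ`, `D` a product of squares of odd primes and `‖t‖₂ > 1`, then `w` is ODD
(`‖w‖₂ = ‖t‖₂/2 > 1/2`, and even integers have norm `≤ 1/2`). [folklore] -/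
theorem odd_of_eq_two_mul_prod_sq_mul_of_one_lt_norm (S : Finset ℕ) (hS : ∀ ℓ ∈ S, ℓ.Prime) (hS2 : ∀ ℓ ∈ S, ℓ ≠ 2) {w : ℤ} {t : ℚ}
    (hw : (w : ℝ) = ((2 * ((∏ ℓ ∈ S, ℓ ^ 2 : ℕ) : ℚ) * t : ℚ) : ℝ)) (ht : 1 < ‖((t : ℚ) : ℚ_[2])‖) : Odd w := by
  have hwq : (w : ℚ) = 2 * ((∏ ℓ ∈ S, ℓ ^ 2 : ℕ) : ℚ) * t := by exact_mod_cast hw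
  have hnorm : ‖(w : ℚ_[2])‖ = 2⁻¹ * ‖((t : ℚ) : ℚ_[2])‖ := by
    rw [← norm_two_mul_prod_sq_mul S hS hS2 t, ← hwq]; norm_cast
  refine Int.not_even_iff_odd.mp fun heven ↦ ?_
  have hle := norm_le_half_of_even heven
  rw [hnorm] at hle
  linarith

end Tables

/-! ## §3 The `λ`-law against the table witness -/

/-- **The `λ`-law off the Kilford stratum from ONE non-`2`-integral depleted MINUS value of the first curve at a symmetric cusp.** As
`…WitnessMinusLaw.lamLaw_of_not_padicSquare_of_matrix_witness`, with the witness read through §1–§2: a duplicate-free list `l` of places realising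
`SS`, and `γ = (a b; c a) ∈ Γ₀(N')`, `c ≠ 0`, with `1 < ‖(eulerDepleteTableList W₁ l [·]⁻_{f₁})(a/c)‖₂`. (Either curve may play `W₁`.)
[cite: GreenbergVatsal2000, Thm. (1.4) and §3 Remark 3.4] [cite: Buzzard2000LevelLoweringModTwo, Prop. 2.4] [cite: MazurTateTeitelbaum1986Invent, §I.8 and §I.10] -/
theorem lamLaw_of_not_padicSquare_of_minusTable_witness
    (hSD : heckeSelfDual_torsionBy_J0) (hBz : buzzard2000_multiplicityOne_gamma0)
    (W₁ : WeierstrassCurve ℚ) [W₁.IsElliptic] [W₁.IsGloballyMinimal]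
    (W₂ : WeierstrassCurve ℚ) [W₂.IsElliptic] [W₂.IsGloballyMinimal]
    (hord₁ : IsOrdinaryAt W₁ 2) (hord₂ : IsOrdinaryAt W₂ 2)
    (ht₁ : ∀ x : ℚ, ¬ HasRationalTwoTorsionX W₁ x) (ht₂ : ∀ x : ℚ, ¬ HasRationalTwoTorsionX W₂ x)
    (hΔ₂ : ∀ s : ℚ_[2], s ^ 2 ≠ (W₁.Δ : ℚ_[2]))
    {F : Type} [Field F] [NumberField F] (hF : finrank ℚ F = 3)
    {e₁ e₂ : F} (he₁ : aeval e₁ (twoDivisionUCubic W₁) = 0) (he₂ : aeval e₂ (twoDivisionUCubic W₂) = 0)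
    [NeZero (W₁.conductorNorm ℤ)] [NeZero (W₂.conductorNorm ℤ)]
    {f₁ : CuspForm (Gamma0 (W₁.conductorNorm ℤ)) 2} (hf₁ : IsNewformOf W₁ f₁)
    {f₂ : CuspForm (Gamma0 (W₂.conductorNorm ℤ)) 2} (hf₂ : IsNewformOf W₂ f₂)
    {G₁ G₂ : IwasawaAlgebra 2} (hG₁ : IsEvenBranchLiftAtTwo W₁ f₁ G₁) (hG₂ : IsEvenBranchLiftAtTwo W₂ f₂ G₂)
    {q₀ : ℕ} (hq₀ : q₀.Prime) (hq₀2 : q₀ ≠ 2) (hq₀N : ¬ q₀ ∣ W₁.conductorNorm ℤ * W₂.conductorNorm ℤ)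
    (l : List (HeightOneSpectrum (𝓞 ℚ))) (hl : l.Nodup)
    (hlSS : (l.map Rat.HeightOneSpectrum.natGenerator).toFinset = (q₀ * (W₁.conductorNorm ℤ * W₂.conductorNorm ℤ)).primeFactors.erase 2)
    (N' : ℕ) [NeZero N']
    (hN' : N' = q₀ * (W₁.conductorNorm ℤ * W₂.conductorNorm ℤ) * ∏ ℓ ∈ (l.map Rat.HeightOneSpectrum.natGenerator).toFinset, ℓ ^ 2)
    (g₁ g₂ : CuspForm (Gamma0 N') 2)
    (hg₁ : ∀ n : ℕ, cuspCoeff g₁ n = if ∃ ℓ ∈ (l.map Rat.HeightOneSpectrum.natGenerator).toFinset, ℓ ∣ n then 0 else cuspCoeff f₁ n)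
    (hg₂ : ∀ n : ℕ, cuspCoeff g₂ n = if ∃ ℓ ∈ (l.map Rat.HeightOneSpectrum.natGenerator).toFinset, ℓ ∣ n then 0 else cuspCoeff f₂ n)
    (hII : ∃ γ : Gamma0 N', (γ : SL(2, ℤ)) 0 0 = (γ : SL(2, ℤ)) 1 1 ∧ (γ : SL(2, ℤ)) 1 0 ≠ 0 ∧
      1 < ‖((eulerDepleteTableList W₁ l (ratMinusSymbol f₁)
        ((((γ : SL(2, ℤ)) 0 0 : ℤ) : ℚ) / (((γ : SL(2, ℤ)) 1 0 : ℤ) : ℚ)) : ℚ) : ℚ_[2])‖) :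
    lam G₁ + ∑ ℓ ∈ (W₁.conductorNorm ℤ * W₂.conductorNorm ℤ).primeFactors.erase 2, lambdaCorrectionAtTwo W₁ ℓ =
      lam G₂ + ∑ ℓ ∈ (W₁.conductorNorm ℤ * W₂.conductorNorm ℤ).primeFactors.erase 2, lambdaCorrectionAtTwo W₂ ℓ := by
  set SS : Finset ℕ := (l.map Rat.HeightOneSpectrum.natGenerator).toFinset with hSSdef
  have hSSp : ∀ ℓ ∈ SS, ℓ.Prime := fun ℓ hℓ ↦
    Nat.prime_of_mem_primeFactors (Finset.mem_of_mem_erase (hlSS ▸ hℓ))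
  have hSS2 : ∀ ℓ ∈ SS, ℓ ≠ 2 := fun ℓ hℓ ↦ Finset.ne_of_mem_erase (hlSS ▸ hℓ)
  have hNL₁ : W₁.conductorNorm ℤ * ∏ ℓ ∈ SS, ℓ ^ 2 ∣ N' := ⟨q₀ * W₂.conductorNorm ℤ, by rw [hN']; ring⟩
  obtain ⟨γ, hγ, hc, hnorm⟩ := hII
  -- the integer value of the minus functional at `{∞, γ∞}` and its oddness
  -- the `q`-expansion hypotheses in the decidability shapes of the callee files
  have hg₁' : ∀ n : ℕ, cuspCoeff g₁ n = @ite ℂ (∃ ℓ ∈ SS, ℓ ∣ n) (Finset.decidableExistsAndFinsetCoe) 0 (cuspCoeff f₁ n) :=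
    fun n ↦ by convert hg₁ n using 2
  have hg₂' : ∀ n : ℕ, cuspCoeff g₂ n = @ite ℂ (∃ ℓ ∈ SS, ℓ ∣ n) (Finset.decidableExistsAndFinsetCoe) 0 (cuspCoeff f₂ n) :=
    fun n ↦ by convert hg₂ n using 2
  obtain ⟨w, hw⟩ := exists_int_depleted_minusFunctional W₁ hf₁ SS hSSp N' hNL₁ g₁ hg₁' _ (periodFunctional_mem_periodHomology N' γ)
  rw [periodFunctional_apply] at hw
  have hw' := hw
  rw [minusFunctional_cuspSymbol_eq hf₁ l hl N' hNL₁ g₁ (fun n ↦ by convert hg₁ n using 2) γ hc] at hw'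
  have hodd : Odd w := odd_of_eq_two_mul_prod_sq_mul_of_one_lt_norm SS hSSp hSS2 hw'.symm hnorm
  exact lamLaw_of_not_padicSquare_of_matrix_witness hSD hBz W₁ W₂ hord₁ hord₂ ht₁ ht₂ hΔ₂ hF he₁ he₂ hf₁ hf₂ hG₁ hG₂ hq₀ hq₀2 hq₀N
    SS hlSS N' hN' g₁ g₂ hg₁' hg₂' ⟨γ, hγ, w, hw, hodd⟩

end Summit.BirchSwinnertonDyer.BirchSwinnertonDyer.Theorems.AlignedTransportAtTwoOrdPlusLineWitnessMinusTable

end
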